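import Literature.MathematicalPhysics.QuantumFieldTheory.Balaban1983to89.B12AverageCorridor267

/-!
# `T4Continuum.ShellMeasureAverageAnalytic` — WALL §3 W-d, ANALYTIC HALF (generic core): analytic unit-valued BOND
# WORDS with exponential bounds, Schwarz-at-the-origin, and THE CHART AVERAGE `B ↦ (−i)·log(e^{S(B)}T(B)(e^{S(0)}T(0))⁻¹)`
# — ANALYTIC on an explicit sup-ball, `= 0` at `0`, BOUNDED (cell `pub-balaban`, sub-cell `t4`, spine estimate NE7c
# (node U5b), owner lineage `b2b-balaban-t4-ne7c-p1` gen 28, table `LEAVES-NE7c-P1.md` row S49 file 1; imports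
# `B12AverageCorridor267` ONLY (for `expU` and the `MatrixLog` series logarithm); [folklore]; 0 sorry)

HONEST FRAMING.  Finite four-torus programme, rung (B)+1 only — NOT infinite volume, NOT a mass gap, NOT the Clay
problem, NOT summit progress; (B), `BetaPertHyp`, (B^μ) are not consumed.  NE7c (`T4IndicatorShell.ShellWeightBound`)
is NOT PRINTED and NOT PROVED; «NE7c ⇐ the named binders» (WALL `t4/b2b-balaban-t4-ne7c-p1/WALL-NE7c-P1.md` §2).
ELEMENTARY COMPLEX ANALYSIS in a complete normed algebra ([folklore]); nothing printed is asserted or cited; the one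
`structure … : Prop` bundles four elementary facts about a unit-valued map and names no wall binder.  HONEST DEPENDENCY
(cell): continuum YM on T⁴ ⇐ BetaPertH ∧ nine spine estimates (0/9 proved); BetaPertH ⇐ (D1) ∧ (D4) ∧ CAP+tail; G-an2-4
gates asym, D1 and NE2/3/4.

THE POINT.  WALL §3 W-d («linearizability of Bałaban's block average about the step's background on the window,
[Balaban1987RG1] p. 267 TYPE») needs, of the printed average-in-the-chart `Q̃` of (2.4) — tree:
`B12AverageCorridor267.Qtilde` ([Balaban1985Averaging] (15) verbatim instance) —, exactly four facts: `Q̃` is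
complex-ANALYTIC on a ball `‖B′‖ < R`, `Q̃(0) = 0`, `‖Q̃‖ ≤ M_Q` there, and p. 267's `h` is a right inverse of
`DQ̃(0)` (`Beta/LinearizingChange267FromQ` derives the linearizing `D̃`, its quadratic onset and radii from these;
`B12AverageCorridor267`'s typing (c) records «Fréchet differentiability of (2.4) in B′ … NOT proved»).  `Q̃` has the
SHAPE `B ↦ (−i)·log(M(B)·M(0)⁻¹)` with `M(B) = exp[Σ_x a_x log W_x(B)]·T(B)`, where every `W_x(B)`, `T(B)` is a finite
ordered product of factors `(e^{iℓ_b(B)}V(b))^{±1}` — UNIT-VALUED ENTIRE maps with `‖·‖, ‖·⁻¹‖ ≤ e^{w‖B‖}`.  Here: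
the three analytic facts for that SHAPE with explicit radii; the instance for `Qtilde` is file 2.
* §0 `norm_exp_le'`; **`norm_sub_apply_zero_le`** — SCHWARZ AT THE ORIGIN (Mathlib
  `Complex.dist_le_div_mul_dist_of_mapsTo_ball`): `‖f z − f 0‖ ≤ K` on `ball 0 R₀` ⟹ `‖f z − f 0‖ ≤ (K∕R₀)·‖z‖` — the
  device turning crude sup bounds into the uniform Lipschitz-at-`0` bounds that keep every `log` in its disc.
* §1 `ExpWord f w`: `B ↦ f B ∈ 𝔸ˣ`, value and inverse value analytic everywhere, `‖f B‖, ‖(f B)⁻¹‖ ≤ e^{w‖B‖}`; closed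
  under `const`, `mul` (weights add), `inv`, `mono`, `listProd`, `pathProd` (`B7Eq61Linearization.pathProd`); the
  perturbed bond variable `B ↦ expU(i·ℓ(B))·v` of `B12AverageCorridor267.pert` is an `ExpWord` of weight `1` (`expFactor`).
* §2 `ExpWord.norm_sub_zero_le`: `‖f B − f 0‖ ≤ ((e^{wR₀} + 1)∕R₀)·‖B‖` on `‖B‖ < R₀`.
* §3 with `‖f 0 − 1‖ ≤ ε`, `ε + ((e^{wR₀}+1)∕R₀)·R₁ ≤ 1∕2`, on `‖B‖ < R₁ ≤ R₀`: `‖f B − 1‖ ≤ 1∕2`, `B ↦ mlog (f B)`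
  analytic, `‖mlog (f B)‖ ≤ 1` (`MatrixLog.analyticAt_mlog`, `norm_mlog_le_two_mul`).
* §4 the exponent `S(B) = Σ_{x∈s} a_x • mlog (W_x B)`, `Σ‖a_x‖ ≤ 1`: analytic on the ball, `‖S B‖ ≤ 1`.
* §5 the quotient `Z(B) = ((expU (S B)·T B·(expU (S 0)·T 0)⁻¹ : 𝔸ˣ) : 𝔸)`: analytic, `Z 0 = 1`,
  `‖Z B − 1‖ ≤ e^{2 + w_T R₁} + 1`, hence (Schwarz) `≤ ((e^{2+w_T R₁}+1)∕R₁)·‖B‖` on `‖B‖ < R₁`.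
* §6 **`chartAverage_analyticOnNhd`**, **`chartAverage_zero`**, **`norm_chartAverage_le_mul`**: for
  `F B := (−I) • mlog (Z B)`, `R ≤ R₁`, `((e^{2+w_T R₁}+1)∕R₁)·R ≤ 1∕2`: `AnalyticOnNhd ℂ F (ball 0 R)`, `F 0 = 0`,
  `‖F B‖ ≤ 2((e^{2+w_T R₁}+1)∕R₁)·‖B‖ (≤ 1)`.
NOT HERE: the block geometry (file 2); `fderiv = B12AverageCorridor267.LQ` (row S48); reality (row S47); the junction
to S36∕S40 (row S46); anything about Bałaban's minimisers or densities.
-/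

noncomputable section

open NormedSpace Metric Set

namespace Summit.QuantumFields.BalabanUV.T4Continuum.ShellMeasureAverageAnalytic

open Literature.MathematicalPhysics.QuantumFieldTheory.Balaban1983to89
open B12AverageCorridor267 (expU val_expU val_inv_expU)
open B7Eq61Linearization (pathProd pathProd_zero pathProd_succ)
open MatrixLog (mlog analyticAt_mlog norm_mlog_le_two_mul mlog_one)
open Literature.Analysis.Calculus (norm_exp_sub_one_le)

variable {E : Type*} [NormedAddCommGroup E] [NormedSpace ℂ E]
variable {𝔸 : Type*} [NormedRing 𝔸] [NormedAlgebra ℂ 𝔸]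

/-! ## §0 Two elementary devices -/

/-- `‖e^a‖ ≤ e^{‖a‖}` in a complete normed algebra with `‖1‖ = 1` (from the tree's `‖e^a − 1‖ ≤ e^{‖a‖} − 1`). [folklore] -/
theorem norm_exp_le' [CompleteSpace 𝔸] [NormOneClass 𝔸] (a : 𝔸) : ‖exp a‖ ≤ Real.exp ‖a‖ := by
  have h := norm_exp_sub_one_le a
  calc ‖exp a‖ = ‖(exp a - 1) + 1‖ := by rw [sub_add_cancel]
    _ ≤ ‖exp a - 1‖ + ‖(1 : 𝔸)‖ := norm_add_le _ _
    _ ≤ (Real.exp ‖a‖ - 1) + 1 := by rw [norm_one]; linarith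
    _ = Real.exp ‖a‖ := by ring

/-- **SCHWARZ AT THE ORIGIN** (Mathlib's Schwarz lemma for maps between complex normed spaces, specialised): `f`
complex-differentiable on `ball 0 R₀` with `‖f z − f 0‖ ≤ K` there ⟹ `‖f z − f 0‖ ≤ (K ∕ R₀)·‖z‖` on the ball.
[folklore] -/
theorem norm_sub_apply_zero_le {F : Type*} [NormedAddCommGroup F] [NormedSpace ℂ F] {f : E → F} {R₀ K : ℝ}
    (hf : DifferentiableOn ℂ f (ball 0 R₀)) (hK : ∀ z ∈ ball (0 : E) R₀, ‖f z - f 0‖ ≤ K) {z : E}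
    (hz : z ∈ ball (0 : E) R₀) : ‖f z - f 0‖ ≤ K / R₀ * ‖z‖ := by
  have hmaps : MapsTo f (ball 0 R₀) (closedBall (f 0) K) := fun w hw => by
    rw [mem_closedBall, dist_eq_norm]
    exact hK w hw
  have h := Complex.dist_le_div_mul_dist_of_mapsTo_ball hf hmaps hz
  rwa [dist_eq_norm, dist_eq_norm, sub_zero] at h

/-! ## §1 Unit-valued analytic words with exponential bounds -/

/-- A UNIT-VALUED ENTIRE FAMILY WITH EXPONENTIAL BOUNDS of weight `w ≥ 0`: `B ↦ f B ∈ 𝔸ˣ` with the value and the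
inverse value complex-analytic at every point and `‖f B‖, ‖(f B)⁻¹‖ ≤ e^{w‖B‖}`.  (The shape of every finite
ordered product of perturbed bond variables `(e^{iB′(b)}V(b))^{±1}`, `‖V(b)‖, ‖V(b)⁻¹‖ ≤ 1`.) [folklore] -/
@[folklore]
structure ExpWord (f : E → 𝔸ˣ) (w : ℝ) : Prop where
  /-- the weight is nonnegative -/
  nonneg : 0 ≤ w
  /-- the value is analytic everywhere -/
  an : ∀ B, AnalyticAt ℂ (fun B => ((f B : 𝔸ˣ) : 𝔸)) B
  /-- the inverse value is analytic everywhere -/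
  an_inv : ∀ B, AnalyticAt ℂ (fun B => (((f B)⁻¹ : 𝔸ˣ) : 𝔸)) B
  /-- exponential bound on the value -/
  le : ∀ B, ‖((f B : 𝔸ˣ) : 𝔸)‖ ≤ Real.exp (w * ‖B‖)
  /-- exponential bound on the inverse value -/
  le_inv : ∀ B, ‖(((f B)⁻¹ : 𝔸ˣ) : 𝔸)‖ ≤ Real.exp (w * ‖B‖)

namespace ExpWord

variable {f g : E → 𝔸ˣ} {a b w : ℝ}

/-- A constant unit of norm ≤ 1 with inverse of norm ≤ 1 is an `ExpWord` of weight `0`. [folklore] -/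
theorem const {v : 𝔸ˣ} (h1 : ‖(v : 𝔸)‖ ≤ 1) (h2 : ‖((v⁻¹ : 𝔸ˣ) : 𝔸)‖ ≤ 1) : ExpWord (fun _ : E => v) 0 where
  nonneg := le_rfl
  an _ := analyticAt_const
  an_inv _ := analyticAt_const
  le B := by rw [zero_mul, Real.exp_zero]; exact h1
  le_inv B := by rw [zero_mul, Real.exp_zero]; exact h2

/-- The unit `1` is an `ExpWord` of weight `0` (needs `‖1‖ = 1`). [folklore] -/
theorem one [NormOneClass 𝔸] : ExpWord (fun _ : E => (1 : 𝔸ˣ)) 0 :=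
  const (by rw [Units.val_one, norm_one]) (by rw [inv_one, Units.val_one, norm_one])

/-- Increasing the weight. [folklore] -/
theorem mono (hf : ExpWord f a) (hab : a ≤ b) : ExpWord f b where
  nonneg := hf.nonneg.trans hab
  an := hf.an
  an_inv := hf.an_inv
  le B := (hf.le B).trans (Real.exp_le_exp.2 (mul_le_mul_of_nonneg_right hab (norm_nonneg B)))
  le_inv B := (hf.le_inv B).trans (Real.exp_le_exp.2 (mul_le_mul_of_nonneg_right hab (norm_nonneg B)))

/-- Inverses: same weight. [folklore] -/
theorem inv (hf : ExpWord f a) : ExpWord (fun B => (f B)⁻¹) a where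
  nonneg := hf.nonneg
  an := hf.an_inv
  an_inv B := by simp only [inv_inv]; exact hf.an B
  le := hf.le_inv
  le_inv B := by simp only [inv_inv]; exact hf.le B

/-- Products: weights add (`‖fg‖ ≤ ‖f‖‖g‖`, `(fg)⁻¹ = g⁻¹f⁻¹`). [folklore] -/
theorem mul (hf : ExpWord f a) (hg : ExpWord g b) : ExpWord (fun B => f B * g B) (a + b) where
  nonneg := add_nonneg hf.nonneg hg.nonneg
  an B := by
    have h : (fun B => (((f B * g B : 𝔸ˣ)) : 𝔸)) = fun B => (f B : 𝔸) * (g B : 𝔸) :=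
      funext fun B => Units.val_mul _ _
    rw [h]
    exact (hf.an B).mul (hg.an B)
  an_inv B := by
    have h : (fun B => ((((f B * g B)⁻¹ : 𝔸ˣ)) : 𝔸)) = fun B => (((g B)⁻¹ : 𝔸ˣ) : 𝔸) * (((f B)⁻¹ : 𝔸ˣ) : 𝔸) :=
      funext fun B => by rw [mul_inv_rev, Units.val_mul]
    rw [h]
    exact (hg.an_inv B).mul (hf.an_inv B)
  le B := by
    rw [Units.val_mul, add_mul, Real.exp_add]
    exact (norm_mul_le _ _).trans (mul_le_mul (hf.le B) (hg.le B) (norm_nonneg _) (Real.exp_pos _).le)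
  le_inv B := by
    rw [mul_inv_rev, Units.val_mul, add_mul, Real.exp_add, mul_comm (Real.exp (a * ‖B‖))]
    exact (norm_mul_le _ _).trans (mul_le_mul (hg.le_inv B) (hf.le_inv B) (norm_nonneg _) (Real.exp_pos _).le)

/-- List products: the weights add up. [folklore] -/
theorem listProd [NormOneClass 𝔸] {ι : Type*} (F : ι → E → 𝔸ˣ) (wt : ι → ℝ) :
    ∀ l : List ι, (∀ i ∈ l, ExpWord (F i) (wt i)) →
      ExpWord (fun B => (l.map fun i => F i B).prod) (l.map wt).sum
  | [], _ => by
    simp only [List.map_nil, List.prod_nil, List.sum_nil]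
    exact one
  | i :: l, h => by
    simp only [List.map_cons, List.prod_cons, List.sum_cons]
    exact (h i (List.mem_cons_self)).mul (listProd F wt l fun j hj => h j (List.mem_cons_of_mem i hj))

/-- `B7Eq61Linearization.pathProd` (ordered product of the first `n` factors): weight `n·w`. [folklore] -/
theorem pathProd [NormOneClass 𝔸] {G : E → ℕ → 𝔸ˣ} (h : ∀ t, ExpWord (fun B => G B t) w) :
    ∀ n : ℕ, ExpWord (fun B => B7Eq61Linearization.pathProd (G B) n) (n * w)
  | 0 => by
    simp only [pathProd_zero, Nat.cast_zero, zero_mul]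
    exact one
  | n + 1 => by
    simp only [pathProd_succ, Nat.cast_succ, add_mul, one_mul]
    exact (pathProd h n).mul (h n)

/-- **The perturbed bond variable** `B ↦ e^{iℓ(B)}·v` (`B12AverageCorridor267.pert`'s factor `expU (I • B′ b) * V b`,
the read-out `ℓ = (B′ ↦ B′ b)` continuous linear with `‖ℓ B‖ ≤ ‖B‖`, `‖v‖, ‖v⁻¹‖ ≤ 1`) is an `ExpWord` of weight `1`:
entire (`NormedSpace.exp_analytic`), `‖e^{iℓ(B)}v‖ ≤ e^{‖B‖}`, `‖v⁻¹e^{−iℓ(B)}‖ ≤ e^{‖B‖}`. [folklore] -/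
theorem expFactor [CompleteSpace 𝔸] [NormOneClass 𝔸] (ℓ : E →L[ℂ] 𝔸) (hℓ : ∀ B, ‖ℓ B‖ ≤ ‖B‖) {v : 𝔸ˣ}
    (h1 : ‖(v : 𝔸)‖ ≤ 1) (h2 : ‖((v⁻¹ : 𝔸ˣ) : 𝔸)‖ ≤ 1) :
    ExpWord (fun B => expU (Complex.I • ℓ B) * v) 1 := by
  have hI : ∀ B, ‖Complex.I • ℓ B‖ ≤ ‖B‖ := fun B => by
    rw [norm_smul, Complex.norm_I, one_mul]; exact hℓ B
  have hlin : ∀ B, AnalyticAt ℂ (fun B => Complex.I • ℓ B) B := fun B => (ℓ.analyticAt B).fun_const_smul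
  have hE : ExpWord (fun B => expU (Complex.I • ℓ B)) 1 :=
    { nonneg := zero_le_one
      an := fun B => by
        simp only [val_expU]
        exact (exp_analytic _).comp (hlin B)
      an_inv := fun B => by
        simp only [val_inv_expU]
        exact (exp_analytic _).comp (hlin B).neg
      le := fun B => by
        rw [val_expU, one_mul]
        exact (norm_exp_le' _).trans (Real.exp_le_exp.2 (hI B))
      le_inv := fun B => by
        rw [val_inv_expU, one_mul]
        exact (norm_exp_le' _).trans (Real.exp_le_exp.2 ((norm_neg _).le.trans (hI B))) }
  simpa using hE.mul (const (E := E) h1 h2)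

end ExpWord

/-! ## §2 The uniform Lipschitz-at-`0` bound of a word (Schwarz) -/

/-- An `ExpWord` of weight `w` moves by at most `((e^{wR₀} + 1)∕R₀)·‖B‖` from its value at `0` on `‖B‖ < R₀`.
[folklore] -/
theorem ExpWord.norm_sub_zero_le {f : E → 𝔸ˣ} {w : ℝ} (hf : ExpWord f w) {R₀ : ℝ} {B : E}
    (hB : ‖B‖ < R₀) : ‖(f B : 𝔸) - (f 0 : 𝔸)‖ ≤ (Real.exp (w * R₀) + 1) / R₀ * ‖B‖ := by
  refine norm_sub_apply_zero_le (f := fun B => ((f B : 𝔸ˣ) : 𝔸)) (fun z _ => (hf.an z).differentiableWithinAt)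
    (fun z hz => ?_) (mem_ball_zero_iff.2 hB)
  rw [mem_ball_zero_iff] at hz
  calc ‖(f z : 𝔸) - (f 0 : 𝔸)‖ ≤ ‖(f z : 𝔸)‖ + ‖(f 0 : 𝔸)‖ := norm_sub_le _ _
    _ ≤ Real.exp (w * ‖z‖) + Real.exp (w * ‖(0 : E)‖) := add_le_add (hf.le z) (hf.le 0)
    _ ≤ Real.exp (w * R₀) + 1 := by
      rw [norm_zero, mul_zero, Real.exp_zero]
      exact add_le_add_left (Real.exp_le_exp.2 (mul_le_mul_of_nonneg_left hz.le hf.nonneg)) 1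

/-! ## §3 The logarithm of a word near `1` -/

section Log

variable {f : E → 𝔸ˣ} {w ε R₀ R₁ : ℝ}

/-- On `‖B‖ < R₁ ≤ R₀`, a word with `‖f 0 − 1‖ ≤ ε` and `ε + ((e^{wR₀}+1)∕R₀)·R₁ ≤ 1∕2` stays within `1∕2` of `1`.
[folklore] -/
theorem ExpWord.norm_sub_one_le_half (hf : ExpWord f w) (hR₀ : 0 < R₀) (hR₁ : R₁ ≤ R₀) (hε : ‖(f 0 : 𝔸) - 1‖ ≤ ε)
    (hq : ε + (Real.exp (w * R₀) + 1) / R₀ * R₁ ≤ 1 / 2) {B : E} (hB : ‖B‖ < R₁) :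
    ‖(f B : 𝔸) - 1‖ ≤ 1 / 2 := by
  have h1 := hf.norm_sub_zero_le (hB.trans_le hR₁)
  have hC : 0 ≤ (Real.exp (w * R₀) + 1) / R₀ := div_nonneg (by positivity) hR₀.le
  calc ‖(f B : 𝔸) - 1‖ = ‖((f B : 𝔸) - (f 0 : 𝔸)) + ((f 0 : 𝔸) - 1)‖ := by rw [sub_add_sub_cancel]
    _ ≤ ‖(f B : 𝔸) - (f 0 : 𝔸)‖ + ‖(f 0 : 𝔸) - 1‖ := norm_add_le _ _
    _ ≤ (Real.exp (w * R₀) + 1) / R₀ * R₁ + ε :=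
        add_le_add (h1.trans (mul_le_mul_of_nonneg_left hB.le hC)) hε
    _ ≤ 1 / 2 := by linarith

/-- … so `B ↦ log (f B)` (`MatrixLog.mlog`, the series (21) of [Balaban1985Averaging]) is analytic there. [folklore] -/
theorem ExpWord.analyticAt_mlog [CompleteSpace 𝔸] (hf : ExpWord f w) (hR₀ : 0 < R₀) (hR₁ : R₁ ≤ R₀)
    (hε : ‖(f 0 : 𝔸) - 1‖ ≤ ε) (hq : ε + (Real.exp (w * R₀) + 1) / R₀ * R₁ ≤ 1 / 2) {B : E} (hB : ‖B‖ < R₁) :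
    AnalyticAt ℂ (fun B => mlog ((f B : 𝔸ˣ) : 𝔸)) B :=
  (MatrixLog.analyticAt_mlog ((hf.norm_sub_one_le_half hR₀ hR₁ hε hq hB).trans_lt (by norm_num))).comp_of_eq
    (hf.an B) rfl

/-- … with `‖log (f B)‖ ≤ 1` (`‖log X‖ ≤ 2‖X − 1‖` for `‖X − 1‖ ≤ 1∕2`). [folklore] -/
theorem ExpWord.norm_mlog_le_one [CompleteSpace 𝔸] (hf : ExpWord f w) (hR₀ : 0 < R₀) (hR₁ : R₁ ≤ R₀) (hε : ‖(f 0 : 𝔸) - 1‖ ≤ ε)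
    (hq : ε + (Real.exp (w * R₀) + 1) / R₀ * R₁ ≤ 1 / 2) {B : E} (hB : ‖B‖ < R₁) :
    ‖mlog ((f B : 𝔸ˣ) : 𝔸)‖ ≤ 1 := by
  have h := hf.norm_sub_one_le_half hR₀ hR₁ hε hq hB
  exact (norm_mlog_le_two_mul h).trans (by linarith)

end Log

/-! ## §4 The exponent `S(B) = Σ_x a_x · log W_x(B)` -/

section Exponent

variable [CompleteSpace 𝔸] {σ : Type*} {s : Finset σ} {a : σ → ℂ} {W : σ → E → 𝔸ˣ} {w ε R₀ R₁ : ℝ}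

/-- The exp-mean-log EXPONENT `B ↦ Σ_{x∈s} a_x • log (W_x B)` of a finite family of words (all of weight `w`, all
within `ε` of `1` at `B = 0`) is analytic on `‖B‖ < R₁`. [folklore] -/
theorem analyticAt_exponent (hW : ∀ x ∈ s, ExpWord (W x) w) (hR₀ : 0 < R₀) (hR₁ : R₁ ≤ R₀)
    (hε : ∀ x ∈ s, ‖(W x 0 : 𝔸) - 1‖ ≤ ε) (hq : ε + (Real.exp (w * R₀) + 1) / R₀ * R₁ ≤ 1 / 2) {B : E}
    (hB : ‖B‖ < R₁) : AnalyticAt ℂ (fun B => ∑ x ∈ s, a x • mlog ((W x B : 𝔸ˣ) : 𝔸)) B :=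
  Finset.analyticAt_fun_sum s fun x hx => ((hW x hx).analyticAt_mlog hR₀ hR₁ (hε x hx) hq hB).fun_const_smul

/-- … and bounded by `Σ_x ‖a_x‖ ≤ 1` there. [folklore] -/
theorem norm_exponent_le (hW : ∀ x ∈ s, ExpWord (W x) w) (hR₀ : 0 < R₀) (hR₁ : R₁ ≤ R₀)
    (hε : ∀ x ∈ s, ‖(W x 0 : 𝔸) - 1‖ ≤ ε) (hq : ε + (Real.exp (w * R₀) + 1) / R₀ * R₁ ≤ 1 / 2)
    (ha : ∑ x ∈ s, ‖a x‖ ≤ 1) {B : E} (hB : ‖B‖ < R₁) : ‖∑ x ∈ s, a x • mlog ((W x B : 𝔸ˣ) : 𝔸)‖ ≤ 1 :=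
  calc ‖∑ x ∈ s, a x • mlog ((W x B : 𝔸ˣ) : 𝔸)‖ ≤ ∑ x ∈ s, ‖a x • mlog ((W x B : 𝔸ˣ) : 𝔸)‖ := norm_sum_le _ _
    _ ≤ ∑ x ∈ s, ‖a x‖ * 1 := Finset.sum_le_sum fun x hx => by
        rw [norm_smul]
        exact mul_le_mul_of_nonneg_left ((hW x hx).norm_mlog_le_one hR₀ hR₁ (hε x hx) hq hB) (norm_nonneg _)
    _ ≤ 1 := by simpa using ha

end Exponent

/-! ## §5 The quotient `Z(B) = e^{S(B)}·T(B)·(e^{S(0)}·T(0))⁻¹` -/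

section Quotient

variable [CompleteSpace 𝔸] [NormOneClass 𝔸] {S : E → 𝔸} {T : E → 𝔸ˣ} {wT R₁ : ℝ}

omit [NormedSpace ℂ E] [NormOneClass 𝔸] in
/-- `Z(0) = 1`. [folklore] -/
theorem quot_zero (S : E → 𝔸) (T : E → 𝔸ˣ) :
    (((expU (S 0) * T 0) * (expU (S 0) * T 0)⁻¹ : 𝔸ˣ) : 𝔸) = 1 := by
  rw [mul_inv_cancel, Units.val_one]

omit [NormedSpace ℂ E] [NormOneClass 𝔸] in
/-- The quotient as a product of values: `Z(B) = e^{S(B)}·T(B)·(T(0)⁻¹·e^{−S(0)})`. [folklore] -/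
theorem val_quot (S : E → 𝔸) (T : E → 𝔸ˣ) (B : E) :
    (((expU (S B) * T B) * (expU (S 0) * T 0)⁻¹ : 𝔸ˣ) : 𝔸)
      = exp (S B) * (T B : 𝔸) * ((((T 0)⁻¹ : 𝔸ˣ) : 𝔸) * exp (-S 0)) := by
  rw [Units.val_mul, Units.val_mul, mul_inv_rev, Units.val_mul, val_expU, val_inv_expU]

omit [NormOneClass 𝔸] in
/-- `Z` is analytic wherever `S` is. [folklore] -/
theorem analyticAt_quot (hT : ExpWord T wT) {B : E} (hS : AnalyticAt ℂ S B) :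
    AnalyticAt ℂ (fun B => (((expU (S B) * T B) * (expU (S 0) * T 0)⁻¹ : 𝔸ˣ) : 𝔸)) B := by
  have h : (fun B => (((expU (S B) * T B) * (expU (S 0) * T 0)⁻¹ : 𝔸ˣ) : 𝔸))
      = fun B => exp (S B) * (T B : 𝔸) * ((((T 0)⁻¹ : 𝔸ˣ) : 𝔸) * exp (-S 0)) := funext (val_quot S T)
  rw [h]
  exact (((exp_analytic _).comp_of_eq hS rfl).mul (hT.an B)).mul analyticAt_const

/-- On `‖B‖ < R₁`, with `‖S‖ ≤ 1` there: `‖Z(B) − 1‖ ≤ e^{2 + w_T R₁} + 1`. [folklore] -/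
theorem norm_quot_sub_one_le (hT : ExpWord T wT) (hR₁ : 0 < R₁) (hS : ∀ B : E, ‖B‖ < R₁ → ‖S B‖ ≤ 1) {B : E}
    (hB : ‖B‖ < R₁) :
    ‖(((expU (S B) * T B) * (expU (S 0) * T 0)⁻¹ : 𝔸ˣ) : 𝔸) - 1‖ ≤ Real.exp (2 + wT * R₁) + 1 := by
  have h0 : ‖S 0‖ ≤ 1 := hS 0 (by rwa [norm_zero])
  have h1 : ‖exp (S B)‖ ≤ Real.exp 1 := (norm_exp_le' _).trans (Real.exp_le_exp.2 (hS B hB))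
  have h2 : ‖(T B : 𝔸)‖ ≤ Real.exp (wT * R₁) :=
    (hT.le B).trans (Real.exp_le_exp.2 (mul_le_mul_of_nonneg_left hB.le hT.nonneg))
  have h3 : ‖(((T 0)⁻¹ : 𝔸ˣ) : 𝔸)‖ ≤ 1 := by
    have := hT.le_inv 0
    rwa [norm_zero, mul_zero, Real.exp_zero] at this
  have h4 : ‖exp (-S 0)‖ ≤ Real.exp 1 :=
    (norm_exp_le' _).trans (Real.exp_le_exp.2 ((norm_neg _).le.trans h0))
  have hZ : ‖(((expU (S B) * T B) * (expU (S 0) * T 0)⁻¹ : 𝔸ˣ) : 𝔸)‖ ≤ Real.exp (2 + wT * R₁) := by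
    rw [val_quot]
    calc ‖exp (S B) * (T B : 𝔸) * ((((T 0)⁻¹ : 𝔸ˣ) : 𝔸) * exp (-S 0))‖
        ≤ (‖exp (S B)‖ * ‖(T B : 𝔸)‖) * (‖(((T 0)⁻¹ : 𝔸ˣ) : 𝔸)‖ * ‖exp (-S 0)‖) :=
          (norm_mul_le _ _).trans (mul_le_mul (norm_mul_le _ _) (norm_mul_le _ _) (norm_nonneg _)
            (mul_nonneg (norm_nonneg _) (norm_nonneg _)))
      _ ≤ (Real.exp 1 * Real.exp (wT * R₁)) * (1 * Real.exp 1) :=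
          mul_le_mul (mul_le_mul h1 h2 (norm_nonneg _) (Real.exp_pos _).le)
            (mul_le_mul h3 h4 (norm_nonneg _) zero_le_one) (mul_nonneg (norm_nonneg _) (norm_nonneg _))
            (mul_nonneg (Real.exp_pos _).le (Real.exp_pos _).le)
      _ = Real.exp (2 + wT * R₁) := by
          rw [one_mul, ← Real.exp_add, ← Real.exp_add]; ring_nf
  calc ‖(((expU (S B) * T B) * (expU (S 0) * T 0)⁻¹ : 𝔸ˣ) : 𝔸) - 1‖
      ≤ ‖(((expU (S B) * T B) * (expU (S 0) * T 0)⁻¹ : 𝔸ˣ) : 𝔸)‖ + ‖(1 : 𝔸)‖ := norm_sub_le _ _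
    _ ≤ Real.exp (2 + wT * R₁) + 1 := by rw [norm_one]; exact add_le_add_left hZ 1

/-- Hence (SCHWARZ) `‖Z(B) − 1‖ ≤ ((e^{2+w_T R₁} + 1)∕R₁)·‖B‖` on `‖B‖ < R₁`. [folklore] -/
theorem norm_quot_sub_one_le_mul (hT : ExpWord T wT) (hR₁ : 0 < R₁)
    (hSan : ∀ B : E, ‖B‖ < R₁ → AnalyticAt ℂ S B) (hS : ∀ B : E, ‖B‖ < R₁ → ‖S B‖ ≤ 1) {B : E} (hB : ‖B‖ < R₁) :
    ‖(((expU (S B) * T B) * (expU (S 0) * T 0)⁻¹ : 𝔸ˣ) : 𝔸) - 1‖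
      ≤ (Real.exp (2 + wT * R₁) + 1) / R₁ * ‖B‖ := by
  have h := norm_sub_apply_zero_le
    (f := fun B => (((expU (S B) * T B) * (expU (S 0) * T 0)⁻¹ : 𝔸ˣ) : 𝔸)) (R₀ := R₁)
    (K := Real.exp (2 + wT * R₁) + 1)
    (fun z hz => (analyticAt_quot hT (hSan z (mem_ball_zero_iff.1 hz))).differentiableWithinAt)
    (fun z hz => by rw [quot_zero]; exact norm_quot_sub_one_le hT hR₁ hS (mem_ball_zero_iff.1 hz))
    (mem_ball_zero_iff.2 hB)
  rwa [quot_zero] at h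

end Quotient

/-! ## §6 The chart average `F(B) = (−i)·log Z(B)`: analytic on `ball 0 R`, `F(0) = 0`, `‖F‖ ≤ 1` -/

section ChartAverage

variable [CompleteSpace 𝔸] [NormOneClass 𝔸] {S : E → 𝔸} {T : E → 𝔸ˣ} {wT R₁ R : ℝ}

/-- On the smaller ball `‖B‖ < R ≤ R₁` with `((e^{2+w_T R₁}+1)∕R₁)·R ≤ 1∕2`: `‖Z(B) − 1‖ ≤ 1∕2`. [folklore] -/
theorem norm_quot_sub_one_le_half (hT : ExpWord T wT) (hR₁ : 0 < R₁)
    (hSan : ∀ B : E, ‖B‖ < R₁ → AnalyticAt ℂ S B) (hS : ∀ B : E, ‖B‖ < R₁ → ‖S B‖ ≤ 1) (hR : R ≤ R₁)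
    (hK : (Real.exp (2 + wT * R₁) + 1) / R₁ * R ≤ 1 / 2) {B : E} (hB : ‖B‖ < R) :
    ‖(((expU (S B) * T B) * (expU (S 0) * T 0)⁻¹ : 𝔸ˣ) : 𝔸) - 1‖ ≤ 1 / 2 := by
  have hC : 0 ≤ (Real.exp (2 + wT * R₁) + 1) / R₁ := div_nonneg (by positivity) hR₁.le
  exact (norm_quot_sub_one_le_mul hT hR₁ hSan hS (hB.trans_le hR)).trans
    ((mul_le_mul_of_nonneg_left hB.le hC).trans hK)

/-- **THE CHART AVERAGE IS ANALYTIC**: `B ↦ (−i)·log(e^{S(B)}T(B)(e^{S(0)}T(0))⁻¹)` is complex-analytic on a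
neighbourhood of every point of `ball 0 R`. [folklore] -/
theorem chartAverage_analyticOnNhd (hT : ExpWord T wT) (hR₁ : 0 < R₁)
    (hSan : ∀ B : E, ‖B‖ < R₁ → AnalyticAt ℂ S B) (hS : ∀ B : E, ‖B‖ < R₁ → ‖S B‖ ≤ 1) (hR : R ≤ R₁)
    (hK : (Real.exp (2 + wT * R₁) + 1) / R₁ * R ≤ 1 / 2) :
    AnalyticOnNhd ℂ (fun B => (-Complex.I) • mlog (((expU (S B) * T B) * (expU (S 0) * T 0)⁻¹ : 𝔸ˣ) : 𝔸))
      (ball 0 R) := fun B hB => by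
  have hB' : ‖B‖ < R := mem_ball_zero_iff.1 hB
  have hlt : ‖(((expU (S B) * T B) * (expU (S 0) * T 0)⁻¹ : 𝔸ˣ) : 𝔸) - 1‖ < 1 :=
    (norm_quot_sub_one_le_half hT hR₁ hSan hS hR hK hB').trans_lt (by norm_num)
  exact ((MatrixLog.analyticAt_mlog hlt).comp_of_eq (analyticAt_quot hT (hSan B (hB'.trans_le hR)))
    rfl).fun_const_smul

omit [NormedSpace ℂ E] [NormOneClass 𝔸] in
/-- **THE CHART AVERAGE VANISHES AT `0`** (`Z(0) = 1`, `log 1 = 0`). [folklore] -/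
theorem chartAverage_zero (S : E → 𝔸) (T : E → 𝔸ˣ) :
    (-Complex.I) • mlog (((expU (S 0) * T 0) * (expU (S 0) * T 0)⁻¹ : 𝔸ˣ) : 𝔸) = 0 := by
  rw [quot_zero, mlog_one, smul_zero]

/-- **THE CHART AVERAGE IS BOUNDED, LINEARLY IN `‖B‖`**: `‖F(B)‖ ≤ 2((e^{2+w_T R₁}+1)∕R₁)·‖B‖` on `ball 0 R`.
[folklore] -/
theorem norm_chartAverage_le_mul (hT : ExpWord T wT) (hR₁ : 0 < R₁)
    (hSan : ∀ B : E, ‖B‖ < R₁ → AnalyticAt ℂ S B) (hS : ∀ B : E, ‖B‖ < R₁ → ‖S B‖ ≤ 1) (hR : R ≤ R₁)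
    (hK : (Real.exp (2 + wT * R₁) + 1) / R₁ * R ≤ 1 / 2) {B : E} (hB : ‖B‖ < R) :
    ‖(-Complex.I) • mlog (((expU (S B) * T B) * (expU (S 0) * T 0)⁻¹ : 𝔸ˣ) : 𝔸)‖
      ≤ 2 * ((Real.exp (2 + wT * R₁) + 1) / R₁) * ‖B‖ := by
  rw [norm_smul, norm_neg, Complex.norm_I, one_mul]
  have h1 := norm_mlog_le_two_mul (norm_quot_sub_one_le_half hT hR₁ hSan hS hR hK hB)
  have h2 := norm_quot_sub_one_le_mul hT hR₁ hSan hS (hB.trans_le hR)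
  calc ‖mlog (((expU (S B) * T B) * (expU (S 0) * T 0)⁻¹ : 𝔸ˣ) : 𝔸)‖
      ≤ 2 * ‖(((expU (S B) * T B) * (expU (S 0) * T 0)⁻¹ : 𝔸ˣ) : 𝔸) - 1‖ := h1
    _ ≤ 2 * ((Real.exp (2 + wT * R₁) + 1) / R₁ * ‖B‖) := mul_le_mul_of_nonneg_left h2 zero_le_two
    _ = 2 * ((Real.exp (2 + wT * R₁) + 1) / R₁) * ‖B‖ := by ring

end ChartAverage

end Summit.QuantumFields.BalabanUV.T4Continuum.ShellMeasureAverageAnalytic
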